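import Mathlib
import Summits.NavierStokesRegularity.NavierStokesRegularity.Theorems.BarrierStepRungThreeWindowCertificateMarginThree
import Summits.NavierStokesRegularity.NavierStokesRegularity.Theorems.TrappingWindowRungThreeTailEnvelopesTools
import HarnessLib

/-!
# Box reduction of the window certificate in the repaired format K2″ (route `BarrierStepRungThree`)

GLUE-D″ (supports item stmt-NavierStokesRegularity-23648 `WindowCertificateMargin`, repaired format).
The ∃-crux of the repaired line, `WindowCertificateMargin″` (the hypothesis of
`taoLadderRungThree_target_of_windowCertificateMargin₃`, file
`BarrierStepRungThreeWindowCertificateMarginThree.lean`), still contains three clauses quantified over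
ALL lattice states `S F : Fin 4 → ℤ → ℝ` of the REGION″
(`v (win S) ≤ 0`, `S² ≤ 2F`, `0 ≤ F`, per-shell caps `F ≤ q²/2` outside the window, per-coordinate
caps `F_{i,kLo+j} ≤ Φ i j` on the window): the UNDISTURBED DECREASE (26″), the TAIL RATE below the
window (27) and the GOAL (28). Because `quadTerm` reads only the shells `k-1, k, k+1`
(`TailEnvelopes.abs_quadTerm_le_three_shell`) and the REGION″ bounds every amplitude
(`|S_{i,k}| ≤ q_k` outside, `S_{i,kLo+j}² ≤ 2 Φ i j` inside — `WindowBox.region_bounds`), these three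
clauses follow from statements in which the energies `F` no longer occur:

* (26″) from the same inequality asked only for states `S` in the BOX (`WindowBox.decrease_of_box`);
* (27) from ONE scalar inequality per shell `k < kLo` on a majorant `B` of the amplitudes,
  `16·(2^{5k/2}(B_k² + 2 B_k B_{k+1}) + 2^{5(k-1)/2} B_{k-1}²) ≤ ρ_k` (`WindowBox.tail_of_scalar`);
* (28) from the goal implication on the BOX plus the scalar re-entry conditions below the window
  `q_{k+1} ≤ 2^{-θ} r_k` (`k+1 < kLo`) and `2 Φ_{i,0} ≤ (2^{-θ} r_{kLo-1})²` (`WindowBox.goal_of_box`).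

`WindowBox.taoLadderRungThree_target_of_boxCertificate₃` assembles them with the canonical window map
`win S i j = S i (kLo+j)` and field `vf = quadTerm 1 α`: from the finite list of its hypotheses — table,
exponents, a `C¹` clock `v` and continuous goal `g` on `ℝ^{4n}`, the outside profile / envelope
SEQUENCE inequalities, the datum, properness, floor, gradient bound and budget clauses, and the three
box / scalar statements — it concludes the rung `TaoLadderRungThree.Target`. For polynomial `(v, g)`
and an explicit profile every remaining hypothesis is a polynomial (or norm) inequality in finitely many
real variables or an inequality between explicit real sequences: this is the checkable end of the
dictionary, the form in which a rational SOS certificate is to be verified.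

HONEST FRAMING: finite-dimensional bookkeeping plus implications about Tao-type MODEL lattice
pseudo-flows at the dyadic scale ratio (Tao 2016 §6); NO certificate is produced here (that is the
line's open ∃-crux); the conclusion of the main theorem is the class rung TL-M3
(`TaoLadderRungThree.Target`), not the summit Statement; nothing here is a statement about the
Navier–Stokes equations, and NS regularity is not proved by any of this.
-/

noncomputable section

-- the sub-problem namespace `Summit.NavierStokesRegularity.NavierStokesRegularity` repeats the summit name by design (D-0017)
set_option linter.dupNamespace false

namespace Summit.NavierStokesRegularity.NavierStokesRegularity.Theorems

namespace WindowBox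

open Literature.Analysis.FluidPDE Literature.Analysis.FluidPDE.TaoCascade

variable {n : ℕ} {kLo : ℤ}

/-- **REGION″ bounds every amplitude.** On the region of the repaired certificate (`S² ≤ 2F`,
per-shell caps `F_{i,k} ≤ q_k²/2` outside the window `[kLo, kLo+n)`, per-coordinate caps
`F_{i,kLo+j} ≤ Φ i j` inside) one has `|S_{i,k}| ≤ q_k` at every outside shell (`q ≥ 0`) and
`S_{i,kLo+j}² ≤ 2 Φ i j` on the window: the BOX. [cite: Tao2016AveragedNS, §4 (4.10) (the energy
dominates half the squared amplitude)] -/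
theorem region_bounds {S F : Fin 4 → ℤ → ℝ} {q : ℤ → ℝ} {Φ : Fin 4 → Fin n → ℝ}
    (hq : ∀ k, 0 ≤ q k) (hSF : ∀ i k, S i k ^ 2 ≤ 2 * F i k)
    (hout : ∀ i k, (k < kLo ∨ kLo + n ≤ k) → F i k ≤ q k ^ 2 / 2)
    (hwin : ∀ (i : Fin 4) (j : Fin n), F i (kLo + (j : ℕ)) ≤ Φ i j) :
    (∀ (i : Fin 4) (k : ℤ), (k < kLo ∨ kLo + n ≤ k) → |S i k| ≤ q k) ∧
      (∀ (i : Fin 4) (j : Fin n), S i (kLo + (j : ℕ)) ^ 2 ≤ 2 * Φ i j) := by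
  refine ⟨fun i k hk => ?_, fun i j => ?_⟩
  · refine abs_le_of_sq_le_sq ?_ (hq k)
    have h1 := hSF i k
    have h2 := hout i k hk
    linarith
  · have h1 := hSF i (kLo + (j : ℕ))
    have h2 := hwin i j
    linarith

/-- **(26″) from the box.** If the undisturbed decrease
`(fderiv ℝ v (win S)) (quadTerm(S)|window) ≤ -2γ` holds for every lattice state `S` in the BOX
(`v (win S) ≤ 0`, `|S_{i,k}| ≤ q_k` outside the window, `S_{i,kLo+j}² ≤ 2 Φ i j` inside) with
`g (win S) > 0`, then it holds on REGION″ ∩ {g > 0} (clause 26″ of `WindowCertificateMargin″` with the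
canonical window map and field). [cite: PrajnaRantzer2007, §3.4 p. 1009 (pointwise decrease on a
region)] -/
theorem decrease_of_box {α : Fin 4 → Fin 4 → Fin 4 → ℤ × ℤ × ℤ → ℝ}
    {v g : (Fin 4 → Fin n → ℝ) → ℝ} {q : ℤ → ℝ} {Φ : Fin 4 → Fin n → ℝ} {γ : ℝ}
    (hq : ∀ k, 0 ≤ q k)
    (hdec : ∀ S : Fin 4 → ℤ → ℝ, v (fun i (j : Fin n) => S i (kLo + (j : ℕ))) ≤ 0 →
      (∀ (i : Fin 4) (k : ℤ), (k < kLo ∨ kLo + n ≤ k) → |S i k| ≤ q k) →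
      (∀ (i : Fin 4) (j : Fin n), S i (kLo + (j : ℕ)) ^ 2 ≤ 2 * Φ i j) →
      0 < g (fun i (j : Fin n) => S i (kLo + (j : ℕ))) →
      (fderiv ℝ v (fun i (j : Fin n) => S i (kLo + (j : ℕ))))
        (fun i (j : Fin n) => quadTerm 1 α (fun i' k' (_ : ℝ) => S i' k') i (kLo + (j : ℕ)) 0) ≤
        -(2 * γ)) :
    ∀ (S F : Fin 4 → ℤ → ℝ), (v (fun i (j : Fin n) => S i (kLo + (j : ℕ))) ≤ 0 ∧
      (∀ i k, S i k ^ 2 ≤ 2 * F i k) ∧ (∀ i k, 0 ≤ F i k) ∧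
      (∀ i k, (k < kLo ∨ kLo + n ≤ k) → F i k ≤ q k ^ 2 / 2) ∧
      (∀ (i : Fin 4) (j : Fin n), F i (kLo + (j : ℕ)) ≤ Φ i j)) →
      0 < g (fun i (j : Fin n) => S i (kLo + (j : ℕ))) →
      (fderiv ℝ v (fun i (j : Fin n) => S i (kLo + (j : ℕ))))
        (fun i (j : Fin n) => quadTerm 1 α (fun i' k' (_ : ℝ) => S i' k') i (kLo + (j : ℕ)) 0) ≤
        -(2 * γ) := by
  intro S F hreg hg
  obtain ⟨hv, hSF, -, hout, hwin⟩ := hreg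
  obtain ⟨hb1, hb2⟩ := region_bounds (kLo := kLo) hq hSF hout hwin
  exact hdec S hv hb1 hb2 hg

/-- **(27) from a scalar profile inequality.** Let `B` majorise the amplitudes at the shells `≤ kLo`
of every REGION″ state (`q_k ≤ B_k` for `k < kLo`, `2 Φ_{i,0} ≤ B_{kLo}²`, `0 ≤ B_{kLo}`). If for every
shell `k < kLo` the three-shell size of the cascade nonlinearity is within the profile rate,
`16·(2^{5k/2}(B_k B_k + 2 B_k B_{k+1}) + 2^{5(k-1)/2} B_{k-1} B_{k-1}) ≤ ρ_k`, then the TAIL RATE clause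
holds: `quadTerm_k(S)·S_{i,k} ≤ ρ_k |S_{i,k}|` below the window on REGION″ (the table has `|α| ≤ 1` on
the shift set). [cite: Tao2016AveragedNS, §4 (4.8)–(4.9) (the bilinear term on the shift set couples
shells `k-1, k, k+1`)] -/
theorem tail_of_scalar {α : Fin 4 → Fin 4 → Fin 4 → ℤ × ℤ × ℤ → ℝ} {R : ℝ}
    (hα : InTableClass R α) {v : (Fin 4 → Fin n → ℝ) → ℝ} {q ρ B : ℤ → ℝ}
    {Φ : Fin 4 → Fin n → ℝ} (hkLo : kLo ≤ 0) (hkn : (2 : ℤ) ≤ kLo + n) (hq : ∀ k, 0 ≤ q k)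
    (hBout : ∀ k, k < kLo → q k ≤ B k)
    (hBwin : ∀ (i : Fin 4) (j : Fin n), (j : ℕ) = 0 → 2 * Φ i j ≤ B kLo ^ 2) (hB0 : 0 ≤ B kLo)
    (htail : ∀ k : ℤ, k < kLo →
      16 * ((1 + 1 : ℝ) ^ ((5 : ℝ) * (k : ℝ) / 2) * (B k * B k + 2 * (B k * B (k + 1))) +
        (1 + 1 : ℝ) ^ ((5 : ℝ) * ((k - 1 : ℤ) : ℝ) / 2) * (B (k - 1) * B (k - 1))) ≤ ρ k) :
    ∀ (S F : Fin 4 → ℤ → ℝ), (v (fun i (j : Fin n) => S i (kLo + (j : ℕ))) ≤ 0 ∧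
      (∀ i k, S i k ^ 2 ≤ 2 * F i k) ∧ (∀ i k, 0 ≤ F i k) ∧
      (∀ i k, (k < kLo ∨ kLo + n ≤ k) → F i k ≤ q k ^ 2 / 2) ∧
      (∀ (i : Fin 4) (j : Fin n), F i (kLo + (j : ℕ)) ≤ Φ i j)) →
      ∀ (i : Fin 4) (k : ℤ), k < kLo →
        quadTerm 1 α (fun i' k' (_ : ℝ) => S i' k') i k 0 * S i k ≤ ρ k * |S i k| := by
  intro S F hreg i k hk
  obtain ⟨-, hSF, -, hout, hwin⟩ := hreg
  obtain ⟨hb1, hb2⟩ := region_bounds (kLo := kLo) hq hSF hout hwin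
  have hn : 0 < n := by omega
  -- amplitude bounds at the three shells `k-1, k, k+1 ≤ kLo`
  have ha : ∀ j : Fin 4, |(fun i' k' (_ : ℝ) => S i' k') j (k - 1) 0| ≤ B (k - 1) := fun j =>
    (hb1 j (k - 1) (Or.inl (by omega))).trans (hBout _ (by omega))
  have hb : ∀ j : Fin 4, |(fun i' k' (_ : ℝ) => S i' k') j k 0| ≤ B k := fun j =>
    (hb1 j k (Or.inl hk)).trans (hBout _ hk)
  have hd : ∀ j : Fin 4, |(fun i' k' (_ : ℝ) => S i' k') j (k + 1) 0| ≤ B (k + 1) := by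
    intro j
    rcases lt_or_ge (k + 1) kLo with h1 | h1
    · exact (hb1 j (k + 1) (Or.inl h1)).trans (hBout _ h1)
    · have hk1 : k + 1 = kLo := le_antisymm (by omega) h1
      have hsq : S j kLo ^ 2 ≤ B kLo ^ 2 := by
        have h2 := hb2 j ⟨0, hn⟩
        have h3 := hBwin j ⟨0, hn⟩ rfl
        simp only [Nat.cast_zero, add_zero] at h2
        linarith
      simpa [hk1] using abs_le_of_sq_le_sq hsq hB0
  have hα1 : ∀ (i₁ i₂ i₃ : Fin 4) (μ : ℤ × ℤ × ℤ), μ ∈ shiftSet → |α i₁ i₂ i₃ μ| ≤ 1 :=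
    fun i₁ i₂ i₃ μ hμ => (hα.2.2 i₁ i₂ i₃ μ hμ).1
  have hQ := TailEnvelopes.abs_quadTerm_le_three_shell (ε₀ := 1) (by norm_num) α hα1
    (fun i' k' (_ : ℝ) => S i' k') i k 0 ha hb hd
  have hQ' : |quadTerm 1 α (fun i' k' (_ : ℝ) => S i' k') i k 0| ≤ ρ k := by
    refine hQ.trans (le_trans ?_ (htail k hk))
    norm_num
  calc quadTerm 1 α (fun i' k' (_ : ℝ) => S i' k') i k 0 * S i k
      ≤ |quadTerm 1 α (fun i' k' (_ : ℝ) => S i' k') i k 0 * S i k| := le_abs_self _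
    _ = |quadTerm 1 α (fun i' k' (_ : ℝ) => S i' k') i k 0| * |S i k| := abs_mul _ _
    _ ≤ ρ k * |S i k| := mul_le_mul_of_nonneg_right hQ' (abs_nonneg _)

/-- **(28) from the box and the re-entry conditions.** If on the BOX the goal implication holds —
`g (win S) ≤ 0 ⇒ 2^{-θ} ≤ |S_{i₀,1}|`, `v ≤ 0 < g` at the shifted rescaled window state
`(S_{i,1+kLo+j} / |S_{i₀,1}|)` — and the profile re-enters below the window
(`q_{k+1} ≤ 2^{-θ} r_k` for `k + 1 < kLo`, `2 Φ_{i,0} ≤ (2^{-θ} r_{kLo-1})²`), then the GOAL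
clause of the repaired certificate holds on REGION″, including its outside conjunct
`F_{i,1+k} / |S_{i₀,1}|² ≤ r_k²/2` (`k < kLo`). [cite: Tao2016AveragedNS, §6.4 Prop. 6.5
(the rescaled restart `a_k = e_N⁻¹ X_{N+k}`) with §4 (4.10)] -/
theorem goal_of_box {v g : (Fin 4 → Fin n → ℝ) → ℝ} {r q : ℤ → ℝ} {Φ : Fin 4 → Fin n → ℝ}
    {θ : ℝ} {i₀ : Fin 4} (hkLo : kLo ≤ 0) (hkn : (2 : ℤ) ≤ kLo + n)
    (hq : ∀ k, 0 ≤ q k)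
    (hgoal : ∀ S : Fin 4 → ℤ → ℝ, v (fun i (j : Fin n) => S i (kLo + (j : ℕ))) ≤ 0 →
      (∀ (i : Fin 4) (k : ℤ), (k < kLo ∨ kLo + n ≤ k) → |S i k| ≤ q k) →
      (∀ (i : Fin 4) (j : Fin n), S i (kLo + (j : ℕ)) ^ 2 ≤ 2 * Φ i j) →
      g (fun i (j : Fin n) => S i (kLo + (j : ℕ))) ≤ 0 →
      (1 + 1 : ℝ) ^ (-θ) ≤ |S i₀ 1| ∧
        v (fun i (j : Fin n) => S i (1 + (kLo + (j : ℕ))) / |S i₀ 1|) ≤ 0 ∧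
        0 < g (fun i (j : Fin n) => S i (1 + (kLo + (j : ℕ))) / |S i₀ 1|))
    (hgoalq : ∀ k : ℤ, k + 1 < kLo → q (k + 1) ≤ (1 + 1 : ℝ) ^ (-θ) * r k)
    (hgoalΦ : ∀ (i : Fin 4) (j : Fin n), (j : ℕ) = 0 →
      2 * Φ i j ≤ ((1 + 1 : ℝ) ^ (-θ) * r (kLo - 1)) ^ 2) :
    ∀ (S F : Fin 4 → ℤ → ℝ), (v (fun i (j : Fin n) => S i (kLo + (j : ℕ))) ≤ 0 ∧
      (∀ i k, S i k ^ 2 ≤ 2 * F i k) ∧ (∀ i k, 0 ≤ F i k) ∧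
      (∀ i k, (k < kLo ∨ kLo + n ≤ k) → F i k ≤ q k ^ 2 / 2) ∧
      (∀ (i : Fin 4) (j : Fin n), F i (kLo + (j : ℕ)) ≤ Φ i j)) →
      g (fun i (j : Fin n) => S i (kLo + (j : ℕ))) ≤ 0 →
      (1 + 1 : ℝ) ^ (-θ) ≤ |S i₀ 1| ∧
        v (fun i (j : Fin n) => (fun i k => S i (1 + k) / |S i₀ 1|) i (kLo + (j : ℕ))) ≤ 0 ∧
        0 < g (fun i (j : Fin n) => (fun i k => S i (1 + k) / |S i₀ 1|) i (kLo + (j : ℕ))) ∧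
        (∀ i k, k < kLo → F i (1 + k) / |S i₀ 1| ^ 2 ≤ r k ^ 2 / 2) := by
  intro S F hreg hg
  obtain ⟨hv, hSF, hF0, hout, hwin⟩ := hreg
  obtain ⟨hb1, hb2⟩ := region_bounds (kLo := kLo) hq hSF hout hwin
  obtain ⟨ha, hv', hg'⟩ := hgoal S hv hb1 hb2 hg
  have hn : 0 < n := by omega
  refine ⟨ha, hv', hg', fun i k hk => ?_⟩
  have ha0 : 0 < (1 + 1 : ℝ) ^ (-θ) := Real.rpow_pos_of_pos (by norm_num) _
  -- treat the ratio floor `2^{-θ}` as an atom (linear arithmetic does not see through `rpow`)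
  generalize ha₀def : (1 + 1 : ℝ) ^ (-θ) = a₀ at ha ha0 hgoalq hgoalΦ
  have hapos : 0 < |S i₀ 1| := lt_of_lt_of_le ha0 ha
  -- in both cases the cap at shell `1 + k ≤ kLo` is within `(2^{-θ} r_k)² / 2`
  have hF : F i (1 + k) ≤ (a₀ * r k) ^ 2 / 2 := by
    rcases lt_or_ge (1 + k) kLo with h1 | h1
    · have h2 := hout i (1 + k) (Or.inl h1)
      have h3 : q (1 + k) ≤ a₀ * r k := by
        have := hgoalq k (by omega)
        rwa [add_comm k 1] at this
      have h4 : q (1 + k) ^ 2 ≤ (a₀ * r k) ^ 2 := pow_le_pow_left₀ (hq _) h3 2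
      linarith
    · have hk1 : 1 + k = kLo := le_antisymm (by omega) h1
      have h2 := hwin i ⟨0, hn⟩
      have h3 := hgoalΦ i ⟨0, hn⟩ rfl
      simp only [Nat.cast_zero, add_zero] at h2
      have hk2 : kLo - 1 = k := by omega
      rw [hk2] at h3
      rw [hk1]
      linarith
  have hsq : a₀ ^ 2 ≤ |S i₀ 1| ^ 2 := pow_le_pow_left₀ ha0.le ha 2
  calc F i (1 + k) / |S i₀ 1| ^ 2
      ≤ (a₀ * r k) ^ 2 / 2 / |S i₀ 1| ^ 2 := div_le_div_of_nonneg_right hF (sq_nonneg _)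
    _ ≤ r k ^ 2 / 2 := by
        rw [div_le_iff₀ (pow_pos hapos 2)]
        nlinarith [mul_nonneg (sub_nonneg.2 hsq) (sq_nonneg (r k))]

/-- **Rung TL-M3 from a BOX certificate in the repaired format K2″.** All data explicit; the window
map is the canonical `S ↦ (S_{i,kLo+j})` and the field is `quadTerm 1 α`. Hypotheses: the clauses of
`WindowCertificateMargin″` (`BarrierStepRungThreeWindowCertificateMarginThree.lean`) that are already
finite-dimensional or scalar — table `α ∈ InTableClass R`, one-shell datum, exponents, window
containing shells `0, 1`, `C¹` clock `v` and continuous goal `g` on `ℝ^{4n}`, slack majorant `Ψ`,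
profile `(r, q, ρ)` and envelope `env` inequalities, per-coordinate caps `Φ` and properness bounds
`Mw`, datum clauses, properness, clock floor, operator-norm bound `Λ` and absorption budget — VERBATIM,
and the three lattice-state clauses in BOX / scalar form: the undisturbed decrease on the box
(`decrease_of_box`), the tail majorant inequality below the window (`tail_of_scalar`), and the goal on
the box with the re-entry conditions (`goal_of_box`). Conclusion: `TaoLadderRungThree.Target`, by
`taoLadderRungThree_target_of_windowCertificateMargin₃`. For polynomial `(v, g)` and explicit
sequences every hypothesis is a polynomial / norm inequality in finitely many reals or an inequality
of explicit real sequences — the form in which a rational certificate is checked.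
[cite: Tao2016AveragedNS, §6.4 Prop. 6.5 with §6.1–6.2; PrajnaRantzer2007 Thm 3.5 and §3.4] -/
theorem taoLadderRungThree_target_of_boxCertificate₃ {R θ c η γ Λ : ℝ} {i₀ : Fin 4}
    {α : Fin 4 → Fin 4 → Fin 4 → ℤ × ℤ × ℤ → ℝ} {X₀ : Fin 4 → ℝ}
    {v g : (Fin 4 → Fin n → ℝ) → ℝ} {r q ρ env Ψ : ℤ → ℝ} {Mw Φ : Fin 4 → Fin n → ℝ}
    (B : ℤ → ℝ)
    (hR : 1 ≤ R) (hα : InTableClass R α) (hX₀ : X₀ i₀ ≠ 0) (hθ0 : 0 ≤ θ) (hθ : θ ≤ 1 / 2)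
    (hc : 0 < c) (hη : 0 < η) (hγ : 0 < γ) (hkLo : kLo ≤ 0) (hkn : (2 : ℤ) ≤ kLo + n)
    (hv : ContDiff ℝ 1 v) (hg : Continuous g)
    (hΨ : ∀ (L' : ℕ) (k : ℤ), slackWeight 1 θ c env L' k ≤ Ψ k)
    (hprof : ∀ k : ℤ, 0 ≤ r k ∧ r k < q k ∧ 0 ≤ ρ k ∧ r k + c * ρ k ≤ q k ∧ q k ^ 2 / 2 ≤ env k)
    (hup : ∀ k : ℤ, kLo + n ≤ k → (1 + 1 : ℝ) ^ ((5 : ℝ) * ((k - 1 : ℤ) : ℝ) / 2) *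
      (∑ i₁ : Fin 4, ∑ i₂ : Fin 4, ∑ i₃ : Fin 4, |α i₁ i₂ i₃ (0, 0, 1)|) * q (k - 1) ^ 2 ≤ ρ k)
    (hΦq : ∀ (i : Fin 4) (j : Fin n), (j : ℕ) + 1 = n → 2 * Φ i j ≤ q (kLo + (j : ℕ)) ^ 2)
    (hdecay : ∀ k : ℤ, kLo + n ≤ k → q (k + 1) ≤ (1 + 1 : ℝ) ^ (-θ) * r k)
    (hΦ : ∀ (i : Fin 4) (j : Fin n), 0 ≤ Φ i j ∧ Φ i j ≤ env (kLo + (j : ℕ)) ∧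
      Mw i j ^ 2 / 2 + η * Ψ (kLo + (j : ℕ)) +
        η * (1 + 1 : ℝ) ^ ((2 : ℝ) * ((kLo + (j : ℕ) : ℤ) : ℝ)) * c * Φ i j < Φ i j)
    (hM₁ : ∃ M₁ : ℝ, ∀ k : ℤ, kLo + n ≤ k → (1 + (1 + 1 : ℝ) ^ ((10 : ℝ) * (k : ℝ))) * q k ≤ M₁)
    (hv0 : v (fun i (j : Fin n) => datumState i₀ X₀ i (kLo + (j : ℕ))) ≤ 0)
    (hg0 : 0 < g (fun i (j : Fin n) => datumState i₀ X₀ i (kLo + (j : ℕ))))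
    (hproper : ∀ x : Fin 4 → Fin n → ℝ, v x ≤ 0 → ∀ i j, |x i j| ≤ Mw i j)
    (hfloor : ∀ x : Fin 4 → Fin n → ℝ, v x ≤ 0 → 0 < g x → -(γ * c) < v x)
    (hdec : ∀ S : Fin 4 → ℤ → ℝ, v (fun i (j : Fin n) => S i (kLo + (j : ℕ))) ≤ 0 →
      (∀ (i : Fin 4) (k : ℤ), (k < kLo ∨ kLo + n ≤ k) → |S i k| ≤ q k) →
      (∀ (i : Fin 4) (j : Fin n), S i (kLo + (j : ℕ)) ^ 2 ≤ 2 * Φ i j) →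
      0 < g (fun i (j : Fin n) => S i (kLo + (j : ℕ))) →
      (fderiv ℝ v (fun i (j : Fin n) => S i (kLo + (j : ℕ))))
        (fun i (j : Fin n) => quadTerm 1 α (fun i' k' (_ : ℝ) => S i' k') i (kLo + (j : ℕ)) 0) ≤
        -(2 * γ))
    (hΛ : ∀ x : Fin 4 → Fin n → ℝ, v x ≤ 0 → ‖fderiv ℝ v x‖ ≤ Λ) (hΛ0 : 0 ≤ Λ)
    (hbudget : ∀ (i : Fin 4) (j : Fin n),
      Λ * (η * (1 + 1 : ℝ) ^ ((2 : ℝ) * ((kLo + (j : ℕ) : ℤ) : ℝ)) * Real.sqrt (Φ i j)) ≤ γ)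
    (hBout : ∀ k, k < kLo → q k ≤ B k)
    (hBwin : ∀ (i : Fin 4) (j : Fin n), (j : ℕ) = 0 → 2 * Φ i j ≤ B kLo ^ 2) (hB0 : 0 ≤ B kLo)
    (htail : ∀ k : ℤ, k < kLo →
      16 * ((1 + 1 : ℝ) ^ ((5 : ℝ) * (k : ℝ) / 2) * (B k * B k + 2 * (B k * B (k + 1))) +
        (1 + 1 : ℝ) ^ ((5 : ℝ) * ((k - 1 : ℤ) : ℝ) / 2) * (B (k - 1) * B (k - 1))) ≤ ρ k)
    (hgoal : ∀ S : Fin 4 → ℤ → ℝ, v (fun i (j : Fin n) => S i (kLo + (j : ℕ))) ≤ 0 →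
      (∀ (i : Fin 4) (k : ℤ), (k < kLo ∨ kLo + n ≤ k) → |S i k| ≤ q k) →
      (∀ (i : Fin 4) (j : Fin n), S i (kLo + (j : ℕ)) ^ 2 ≤ 2 * Φ i j) →
      g (fun i (j : Fin n) => S i (kLo + (j : ℕ))) ≤ 0 →
      (1 + 1 : ℝ) ^ (-θ) ≤ |S i₀ 1| ∧
        v (fun i (j : Fin n) => S i (1 + (kLo + (j : ℕ))) / |S i₀ 1|) ≤ 0 ∧
        0 < g (fun i (j : Fin n) => S i (1 + (kLo + (j : ℕ))) / |S i₀ 1|))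
    (hgoalq : ∀ k : ℤ, k + 1 < kLo → q (k + 1) ≤ (1 + 1 : ℝ) ^ (-θ) * r k)
    (hgoalΦ : ∀ (i : Fin 4) (j : Fin n), (j : ℕ) = 0 →
      2 * Φ i j ≤ ((1 + 1 : ℝ) ^ (-θ) * r (kLo - 1)) ^ 2) :
    Summit.NavierStokesRegularity.NavierStokesRegularity.Theses.TaoLadderRungThree.Target := by
  have hq : ∀ k, 0 ≤ q k := fun k => ((hprof k).1.trans (hprof k).2.1.le)
  exact taoLadderRungThree_target_of_windowCertificateMargin₃
    ⟨R, θ, c, η, γ, i₀, α, X₀, n, kLo, v, g, r, q, ρ, env, Ψ, Mw, Φ,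
      (fun S i (j : Fin n) => S i (kLo + (j : ℕ))),
      (fun S i k => quadTerm 1 α (fun i' k' (_ : ℝ) => S i' k') i k 0), Λ,
      hR, hα, hX₀, hθ0, hθ, hc, hη, hγ, hkLo, hkn, fun _ _ _ => rfl, fun _ _ _ => rfl, hv, hg, hΨ,
      hprof, hup, hΦq, hdecay, hΦ, hM₁, hv0, hg0, hproper, hfloor,
      decrease_of_box (kLo := kLo) hq hdec, hΛ, hΛ0, hbudget,
      tail_of_scalar (kLo := kLo) hα hkLo hkn hq hBout hBwin hB0 htail,
      goal_of_box (kLo := kLo) hkLo hkn hq hgoal hgoalq hgoalΦ⟩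

/-! ### Free split of the rate (`γ + δ` undisturbed decrease / `δ` absorption budget) -/

/-- **(26″) from the box, any bound.** The undisturbed pairing `(fderiv ℝ v (win S)) (quadTerm(S)|window)`
is bounded by `m` on REGION″ ∩ {g > 0} as soon as it is bounded by `m` for every lattice state in the BOX
(`v (win S) ≤ 0`, `|S_{i,k}| ≤ q_k` outside the window, `S_{i,kLo+j}² ≤ 2 Φ i j` inside) with
`g (win S) > 0` — the energies `F` do not occur. [cite: PrajnaRantzer2007, §3.4 p. 1009 (pointwise
decrease on a region)] -/
theorem decrease_of_box_le {α : Fin 4 → Fin 4 → Fin 4 → ℤ × ℤ × ℤ → ℝ}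
    {v g : (Fin 4 → Fin n → ℝ) → ℝ} {q : ℤ → ℝ} {Φ : Fin 4 → Fin n → ℝ} {m : ℝ}
    (hq : ∀ k, 0 ≤ q k)
    (hdec : ∀ S : Fin 4 → ℤ → ℝ, v (fun i (j : Fin n) => S i (kLo + (j : ℕ))) ≤ 0 →
      (∀ (i : Fin 4) (k : ℤ), (k < kLo ∨ kLo + n ≤ k) → |S i k| ≤ q k) →
      (∀ (i : Fin 4) (j : Fin n), S i (kLo + (j : ℕ)) ^ 2 ≤ 2 * Φ i j) →
      0 < g (fun i (j : Fin n) => S i (kLo + (j : ℕ))) →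
      (fderiv ℝ v (fun i (j : Fin n) => S i (kLo + (j : ℕ))))
        (fun i (j : Fin n) => quadTerm 1 α (fun i' k' (_ : ℝ) => S i' k') i (kLo + (j : ℕ)) 0) ≤
        m) :
    ∀ (S F : Fin 4 → ℤ → ℝ), (v (fun i (j : Fin n) => S i (kLo + (j : ℕ))) ≤ 0 ∧
      (∀ i k, S i k ^ 2 ≤ 2 * F i k) ∧ (∀ i k, 0 ≤ F i k) ∧
      (∀ i k, (k < kLo ∨ kLo + n ≤ k) → F i k ≤ q k ^ 2 / 2) ∧
      (∀ (i : Fin 4) (j : Fin n), F i (kLo + (j : ℕ)) ≤ Φ i j)) →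
      0 < g (fun i (j : Fin n) => S i (kLo + (j : ℕ))) →
      (fderiv ℝ v (fun i (j : Fin n) => S i (kLo + (j : ℕ))))
        (fun i (j : Fin n) => quadTerm 1 α (fun i' k' (_ : ℝ) => S i' k') i (kLo + (j : ℕ)) 0) ≤
        m := by
  intro S F hreg hg
  obtain ⟨hv, hSF, -, hout, hwin⟩ := hreg
  obtain ⟨hb1, hb2⟩ := region_bounds (kLo := kLo) hq hSF hout hwin
  exact hdec S hv hb1 hb2 hg

/-- **Rung TL-M3 from a BOX certificate with a FREE margin split** (`γ + δ` undisturbed / `δ` budget):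
as `taoLadderRungThree_target_of_boxCertificate₃`, with the undisturbed decrease on the box
`≤ -(γ + δ)` and the absorption budget `Λ·η·4^(kLo+j)·√(Φ i j) ≤ δ`, via
`taoLadderRungThree_target_of_windowCertificateMarginSplit₃`; the clock floor then costs only
`c ≥ (1 + δ/γ)·(time to goal)` along a true orbit instead of `2·(time to goal)`.
[cite: Tao2016AveragedNS, §6.4 Prop. 6.5 with §6.1–6.2; PrajnaRantzer2007 Thm 3.5 and §3.4] -/
theorem taoLadderRungThree_target_of_boxCertificateSplit₃ {R θ c η γ Λ δ : ℝ} {i₀ : Fin 4}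
    {α : Fin 4 → Fin 4 → Fin 4 → ℤ × ℤ × ℤ → ℝ} {X₀ : Fin 4 → ℝ}
    {v g : (Fin 4 → Fin n → ℝ) → ℝ} {r q ρ env Ψ : ℤ → ℝ} {Mw Φ : Fin 4 → Fin n → ℝ}
    (B : ℤ → ℝ)
    (hR : 1 ≤ R) (hα : InTableClass R α) (hX₀ : X₀ i₀ ≠ 0) (hθ0 : 0 ≤ θ) (hθ : θ ≤ 1 / 2)
    (hc : 0 < c) (hη : 0 < η) (hγ : 0 < γ) (hkLo : kLo ≤ 0) (hkn : (2 : ℤ) ≤ kLo + n)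
    (hv : ContDiff ℝ 1 v) (hg : Continuous g)
    (hΨ : ∀ (L' : ℕ) (k : ℤ), slackWeight 1 θ c env L' k ≤ Ψ k)
    (hprof : ∀ k : ℤ, 0 ≤ r k ∧ r k < q k ∧ 0 ≤ ρ k ∧ r k + c * ρ k ≤ q k ∧ q k ^ 2 / 2 ≤ env k)
    (hup : ∀ k : ℤ, kLo + n ≤ k → (1 + 1 : ℝ) ^ ((5 : ℝ) * ((k - 1 : ℤ) : ℝ) / 2) *
      (∑ i₁ : Fin 4, ∑ i₂ : Fin 4, ∑ i₃ : Fin 4, |α i₁ i₂ i₃ (0, 0, 1)|) * q (k - 1) ^ 2 ≤ ρ k)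
    (hΦq : ∀ (i : Fin 4) (j : Fin n), (j : ℕ) + 1 = n → 2 * Φ i j ≤ q (kLo + (j : ℕ)) ^ 2)
    (hdecay : ∀ k : ℤ, kLo + n ≤ k → q (k + 1) ≤ (1 + 1 : ℝ) ^ (-θ) * r k)
    (hΦ : ∀ (i : Fin 4) (j : Fin n), 0 ≤ Φ i j ∧ Φ i j ≤ env (kLo + (j : ℕ)) ∧
      Mw i j ^ 2 / 2 + η * Ψ (kLo + (j : ℕ)) +
        η * (1 + 1 : ℝ) ^ ((2 : ℝ) * ((kLo + (j : ℕ) : ℤ) : ℝ)) * c * Φ i j < Φ i j)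
    (hM₁ : ∃ M₁ : ℝ, ∀ k : ℤ, kLo + n ≤ k → (1 + (1 + 1 : ℝ) ^ ((10 : ℝ) * (k : ℝ))) * q k ≤ M₁)
    (hv0 : v (fun i (j : Fin n) => datumState i₀ X₀ i (kLo + (j : ℕ))) ≤ 0)
    (hg0 : 0 < g (fun i (j : Fin n) => datumState i₀ X₀ i (kLo + (j : ℕ))))
    (hproper : ∀ x : Fin 4 → Fin n → ℝ, v x ≤ 0 → ∀ i j, |x i j| ≤ Mw i j)
    (hfloor : ∀ x : Fin 4 → Fin n → ℝ, v x ≤ 0 → 0 < g x → -(γ * c) < v x)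
    (hdec : ∀ S : Fin 4 → ℤ → ℝ, v (fun i (j : Fin n) => S i (kLo + (j : ℕ))) ≤ 0 →
      (∀ (i : Fin 4) (k : ℤ), (k < kLo ∨ kLo + n ≤ k) → |S i k| ≤ q k) →
      (∀ (i : Fin 4) (j : Fin n), S i (kLo + (j : ℕ)) ^ 2 ≤ 2 * Φ i j) →
      0 < g (fun i (j : Fin n) => S i (kLo + (j : ℕ))) →
      (fderiv ℝ v (fun i (j : Fin n) => S i (kLo + (j : ℕ))))
        (fun i (j : Fin n) => quadTerm 1 α (fun i' k' (_ : ℝ) => S i' k') i (kLo + (j : ℕ)) 0) ≤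
        -(γ + δ))
    (hΛ : ∀ x : Fin 4 → Fin n → ℝ, v x ≤ 0 → ‖fderiv ℝ v x‖ ≤ Λ) (hΛ0 : 0 ≤ Λ)
    (hbudget : ∀ (i : Fin 4) (j : Fin n),
      Λ * (η * (1 + 1 : ℝ) ^ ((2 : ℝ) * ((kLo + (j : ℕ) : ℤ) : ℝ)) * Real.sqrt (Φ i j)) ≤ δ)
    (hBout : ∀ k, k < kLo → q k ≤ B k)
    (hBwin : ∀ (i : Fin 4) (j : Fin n), (j : ℕ) = 0 → 2 * Φ i j ≤ B kLo ^ 2) (hB0 : 0 ≤ B kLo)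
    (htail : ∀ k : ℤ, k < kLo →
      16 * ((1 + 1 : ℝ) ^ ((5 : ℝ) * (k : ℝ) / 2) * (B k * B k + 2 * (B k * B (k + 1))) +
        (1 + 1 : ℝ) ^ ((5 : ℝ) * ((k - 1 : ℤ) : ℝ) / 2) * (B (k - 1) * B (k - 1))) ≤ ρ k)
    (hgoal : ∀ S : Fin 4 → ℤ → ℝ, v (fun i (j : Fin n) => S i (kLo + (j : ℕ))) ≤ 0 →
      (∀ (i : Fin 4) (k : ℤ), (k < kLo ∨ kLo + n ≤ k) → |S i k| ≤ q k) →
      (∀ (i : Fin 4) (j : Fin n), S i (kLo + (j : ℕ)) ^ 2 ≤ 2 * Φ i j) →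
      g (fun i (j : Fin n) => S i (kLo + (j : ℕ))) ≤ 0 →
      (1 + 1 : ℝ) ^ (-θ) ≤ |S i₀ 1| ∧
        v (fun i (j : Fin n) => S i (1 + (kLo + (j : ℕ))) / |S i₀ 1|) ≤ 0 ∧
        0 < g (fun i (j : Fin n) => S i (1 + (kLo + (j : ℕ))) / |S i₀ 1|))
    (hgoalq : ∀ k : ℤ, k + 1 < kLo → q (k + 1) ≤ (1 + 1 : ℝ) ^ (-θ) * r k)
    (hgoalΦ : ∀ (i : Fin 4) (j : Fin n), (j : ℕ) = 0 →
      2 * Φ i j ≤ ((1 + 1 : ℝ) ^ (-θ) * r (kLo - 1)) ^ 2) :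
    Summit.NavierStokesRegularity.NavierStokesRegularity.Theses.TaoLadderRungThree.Target := by
  have hq : ∀ k, 0 ≤ q k := fun k => ((hprof k).1.trans (hprof k).2.1.le)
  exact taoLadderRungThree_target_of_windowCertificateMarginSplit₃
    ⟨R, θ, c, η, γ, i₀, α, X₀, n, kLo, v, g, r, q, ρ, env, Ψ, Mw, Φ,
      (fun S i (j : Fin n) => S i (kLo + (j : ℕ))),
      (fun S i k => quadTerm 1 α (fun i' k' (_ : ℝ) => S i' k') i k 0), Λ, δ,
      hR, hα, hX₀, hθ0, hθ, hc, hη, hγ, hkLo, hkn, fun _ _ _ => rfl, fun _ _ _ => rfl, hv, hg, hΨ,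
      hprof, hup, hΦq, hdecay, hΦ, hM₁, hv0, hg0, hproper, hfloor,
      decrease_of_box_le (kLo := kLo) hq hdec, hΛ, hΛ0, hbudget,
      tail_of_scalar (kLo := kLo) hα hkLo hkn hq hBout hBwin hB0 htail,
      goal_of_box (kLo := kLo) hkLo hkn hq hgoal hgoalq hgoalΦ⟩

end WindowBox

end Summit.NavierStokesRegularity.NavierStokesRegularity.Theorems

end
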